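import Literature.AnabelianGeometry.AbsoluteAnabelian.AbsTopIII.MLFLogFrobeniusFunctors

/-!
# [AbsTopIII] Def. 3.1 (iv) in the model: `ι_×`, `ι_log` lie over the identity of the Galois group

[cite: MochizukiAbsTopIII2015, Def 3.1 (iv) p.69] [cite: MochizukiAbsTopIII2015, Cor 3.7 (iii) p.88]

abc-iut-L4-t5 (gen 5), row «COR37-COMPAT-LITERAL», model input for step (2) of
HOME/staging/L4/L4-t5/DISCHARGE-PLAN-Cor37-compat.md: in the MODEL `TFModel.modelSetting p` of the input structure of
Cor. 3.7 (abc-iut-L4-t9 lineage, `MLFLogFrobeniusFunctors`), the natural transformations `ι_× : λ^× → λ^{×pf}` and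
`ι_log : λ^× ∘ log → λ^{×pf}` are "the identity on `Π`" (Def. 3.1 (iv): they are induced by maps of monoids
`k̄^× → (k̄^×)^pf`, equivariant for the SAME `Π`), i.e. whiskered with `𝒩 → 𝔈` they are the canonical
identifications `λ^× ⋙ (𝒩 → 𝔈) ≅ gal ≅ λ^{×pf} ⋙ (𝒩 → 𝔈)` — the hypotheses (H×), (Hlog) under which the `𝔖†_log`
family glues with the universal family `K₀` over `𝔈` (Cor. 3.7 (iii), second clause; the Cor. 3.7 analogue of the
Cor. 3.6 hypothesis `IotaOverGaloisStmt`, F-0360). Proof-only; model-level; nothing here bears on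
[IUTchIII] Cor. 3.12.
-/

set_option autoImplicit false

noncomputable section

namespace Literature.AnabelianGeometry.AbsoluteAnabelian.AbsTopIII

open CategoryTheory

namespace TFModel

variable (p : ℕ) [Fact p.Prime]

/-- **(H×) in the model**: `ι_× ▷ (𝒩 → 𝔈) = (λ^× ≅_𝔈 gal) ≫ (gal ≅_𝔈 λ^{×pf})` — `ι_×` is the identity on `Π`.
[cite: MochizukiAbsTopIII2015, Def 3.1 (iv) p.69] -/
theorem modelSetting_iotaTimes_overGal (A : TFModel p) :
    (modelSetting p).spaceGal.map ((modelSetting p).iotaTimes.app A) =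
      (modelSetting p).lamTimesGal.hom.app A ≫ (modelSetting p).lamTimesPfGal.inv.app A :=
  TopGroupObj.Hom.ext fun _ => rfl

/-- The same, as an equality of natural transformations `λ^× ⋙ (𝒩 → 𝔈) ⟶ λ^{×pf} ⋙ (𝒩 → 𝔈)`.
[cite: MochizukiAbsTopIII2015, Def 3.1 (iv) p.69] -/
theorem modelSetting_whiskerRight_iotaTimes :
    Functor.whiskerRight (modelSetting p).iotaTimes (modelSetting p).spaceGal =
      (modelSetting p).lamTimesGal.hom ≫ (modelSetting p).lamTimesPfGal.inv := by
  ext A : 2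
  exact modelSetting_iotaTimes_overGal p A

/-- **(Hlog) in the model**: `ι_log ▷ (𝒩 → 𝔈) = (log ◁ (λ^× ≅_𝔈 gal)) ≫ logGal ≫ (gal ≅_𝔈 λ^{×pf})` — `ι_log` is the
identity on `Π` (and `log_{T𝔽,T𝔽} = 𝟭`, `logIsoId = refl` in log-coordinates). [cite: MochizukiAbsTopIII2015, Def 3.1 (iv) p.69] -/
theorem modelSetting_iotaLog_overGal (A : TFModel p) :
    (modelSetting p).spaceGal.map ((modelSetting p).iotaLog.app A) =
      (modelSetting p).lamTimesGal.hom.app ((modelSetting p).log.obj A) ≫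
        (modelSetting p).logGal.hom.app A ≫ (modelSetting p).lamTimesPfGal.inv.app A :=
  TopGroupObj.Hom.ext fun _ => rfl

/-- The same, as an equality of natural transformations `log ⋙ λ^× ⋙ (𝒩 → 𝔈) ⟶ λ^{×pf} ⋙ (𝒩 → 𝔈)`.
[cite: MochizukiAbsTopIII2015, Def 3.1 (iv) p.69] -/
theorem modelSetting_whiskerRight_iotaLog :
    Functor.whiskerRight (modelSetting p).iotaLog (modelSetting p).spaceGal =
      (Functor.isoWhiskerLeft (modelSetting p).log (modelSetting p).lamTimesGal).hom ≫
        (modelSetting p).logGal.hom ≫ (modelSetting p).lamTimesPfGal.inv := by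
  ext A : 2
  exact modelSetting_iotaLog_overGal p A

end TFModel

end Literature.AnabelianGeometry.AbsoluteAnabelian.AbsTopIII

end
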